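import Summits.CriticalPhenomena.SAWScalingLimit.Theorems.SAWLeftRightFKGFKGToTraversalBoundSlitNecklaceFarTip
import Summits.CriticalPhenomena.SAWScalingLimit.Theorems.SAWLeftRightFKGFKGToTraversalBoundNecklaceDisintegration
import HarnessLib

/-!
# Slot law, part 2: the slot as a bead, and its weight (chart r4 §1, S1/S2)

Crux `SAWLeftRightFKG.FKGToTraversalBound` (stmt-CriticalPhenomena-1878), line `slit-necklace` (reshape r4),
stub `stub_slotLaw : SlotLaw` (lead prover-line-stmt-CriticalPhenomena-1878-c5-0), chart
`Cruxes/FKGToTraversalBound/Lines/slit-necklace-chart-r4.md` §1.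

For a self-avoiding chord `p : a₀ → b₀` of `Ω_δ` and indices `τ ≤ τ' ≤ |p|` put `ω₁ := p.take τ`,
`ω₂ := p.drop τ'`, `t := p τ`, `t' := p τ'` and let `K ⊇ Sp` be the spine together with the vertices of `p` of
index `< τ` or `> τ'` (membership hypothesis `hK`, the avoidance clause of `HasFarTipWitness`).

* `getVert_take_append_append_drop` — the vertices of `ω₁ · β · ω₂`;
* `inSlot_iff_exists_bead` — the SLOT of `p` in index form (same prefix up to `τ`, same suffix from some
  `τ'' ≥ τ`, off the spine on `[τ, τ'']`; the currency of part 1, `…SlotCombinatorics`) is exactly the bead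
  event `{γ | γ.walk = ω₁ · β · ω₂, β avoids K}` of `GatesByBubbleDoorsByFKG.necklace_beadIdentity` (p126690);
* `weight_slotBead_eq` — the bead identity for this `K`: `w_Ω(slot ∧ P(β)) = x_c^{|ω₁|+|ω₂|} · w_{Ω'}(t, t')(P)`
  for every `Ω'` presenting `Ω_δ` restricted to `Keep(t', K)`;
* `weight_le_ofReal_mul_weight` — hence `w_Ω(slot ∧ P(β)) ≤ ε · w_Ω(slot)` as soon as
  `law_{Ω'}(t, t')(P) ≤ ε` and `Z_{Ω'}(t, t') < ∞` (product formula S2, in the inequality form the slot law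
  sums over the disjoint slots).

All statements folklore; no literature fact; axioms are the standard three.
-/

noncomputable section

open MeasureTheory Filter Topology Set Metric
open scoped NNReal ENNReal
open Literature.Probability.LatticeModels
open Literature.Probability.RandomPlanarGeometry
open Literature.Probability.RandomPlanarGeometry.SAW
open Summit.CriticalPhenomena.SAWScalingLimit.Theorems.FKGToTraversalBound.Negative (dom)

namespace Summit.CriticalPhenomena.SAWScalingLimit.Theorems.FKGToTraversalBound.SlitNecklace

section WalkAPI

variable {V : Type*} {G : SimpleGraph V} {u v : V}

/-- The vertices of a prefix `p.take n` (`n ≤ |p|`) are the `p m`, `m ≤ n`. [folklore] -/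
theorem mem_support_take_iff {p : G.Walk u v} {n : ℕ} (hn : n ≤ p.length) {z : V} :
    z ∈ (p.take n).support ↔ ∃ m, m ≤ n ∧ p.getVert m = z := by
  rw [SimpleGraph.Walk.mem_support_iff_exists_getVert]
  simp only [SimpleGraph.Walk.take_getVert, SimpleGraph.Walk.take_length]
  constructor
  · rintro ⟨m, hm, -⟩
    exact ⟨min n m, min_le_left _ _, hm⟩
  · rintro ⟨m, hm, hmz⟩
    exact ⟨m, by rw [min_eq_right hm]; exact hmz, le_min hm (hm.trans hn)⟩

/-- The vertices of a suffix `p.drop n` (`n ≤ |p|`) are the `p m`, `n ≤ m ≤ |p|`. [folklore] -/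
theorem mem_support_drop_iff {p : G.Walk u v} {n : ℕ} (hn : n ≤ p.length) {z : V} :
    z ∈ (p.drop n).support ↔ ∃ m, n ≤ m ∧ m ≤ p.length ∧ p.getVert m = z := by
  rw [SimpleGraph.Walk.mem_support_iff_exists_getVert]
  simp only [SimpleGraph.Walk.drop_getVert, SimpleGraph.Walk.drop_length]
  constructor
  · rintro ⟨m, hm, hml⟩
    exact ⟨n + m, Nat.le_add_right _ _, by omega, hm⟩
  · rintro ⟨m, hnm, hmL, hmz⟩
    exact ⟨m - n, by rw [Nat.add_sub_cancel' hnm]; exact hmz, by omega⟩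

/-- The vertices of `p.take τ · β · p.drop τ'`: the prefix of `p` up to `τ`, then `β`, then the suffix of `p`
from `τ'`. [folklore] -/
theorem getVert_take_append_append_drop (p : G.Walk u v) {τ τ' : ℕ} (hττ' : τ ≤ τ') (hτ'L : τ' ≤ p.length)
    (β : G.Walk (p.getVert τ) (p.getVert τ')) (k : ℕ) :
    ((p.take τ).append (β.append (p.drop τ'))).getVert k =
      if k < τ then p.getVert k else if k ≤ τ + β.length then β.getVert (k - τ)
        else p.getVert (k - β.length + τ' - τ) := by
  rw [SimpleGraph.Walk.getVert_append, SimpleGraph.Walk.take_length, min_eq_left (hττ'.trans hτ'L)]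
  split_ifs with h₁ h₂
  · rw [SimpleGraph.Walk.take_getVert, min_eq_right h₁.le]
  · rw [SimpleGraph.Walk.getVert_append]
    split_ifs with h₃
    · rfl
    · have hk : k - τ = β.length := by omega
      rw [hk, Nat.sub_self, SimpleGraph.Walk.drop_getVert, add_zero, SimpleGraph.Walk.getVert_length]
  · rw [SimpleGraph.Walk.getVert_append, if_neg (by omega), SimpleGraph.Walk.drop_getVert]
    congr 1
    omega

end WalkAPI

section SlotBead

variable {Ω Ω' : Set ℂ} {δ : ℝ} {a₀ b₀ : Site 2}

/-- **The slot in index form is the bead event.**  For a chord `γ` of `Ω_δ` from `a₀` to `b₀` (self-avoiding)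
and `K ⊇ Sp` the spine together with the vertices of `p` of index `< τ` or `> τ'`: `γ` agrees with `p` up to
`τ`, carries the suffix `p(τ') …` from some index `τ'' ≥ τ` and stays off `Sp` on `[τ, τ'']` iff
`γ.walk = p.take τ · β · p.drop τ'` for a walk `β : p τ → p τ'` avoiding `K` (then `β` is the middle
`γ(τ) … γ(τ'')`; it avoids the prefix and the suffix because `γ` is self-avoiding). [folklore] -/
theorem inSlot_iff_exists_bead {Sp K : Set (Site 2)} {p : (discreteDomainGraph Ω δ).Walk a₀ b₀}
    {τ τ' : ℕ} (hττ' : τ ≤ τ') (hτ'L : τ' ≤ p.length)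
    (hK : ∀ z, z ∈ K ↔ z ∈ Sp ∨ ∃ m, m ≤ p.length ∧ (m < τ ∨ τ' < m) ∧ p.getVert m = z)
    (γ : DomainSAW Ω δ a₀ b₀) :
    ((∀ m, m ≤ τ → γ.walk.getVert m = p.getVert m) ∧
        ∃ τ'', τ ≤ τ'' ∧ τ'' ≤ γ.walk.length ∧ γ.walk.length + τ' = p.length + τ'' ∧
          (∀ m, γ.walk.getVert (τ'' + m) = p.getVert (τ' + m)) ∧
          ∀ m, τ ≤ m → m ≤ τ'' → γ.walk.getVert m ∉ Sp) ↔
      ∃ β : (discreteDomainGraph Ω δ).Walk (p.getVert τ) (p.getVert τ'),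
        γ.walk = (p.take τ).append (β.append (p.drop τ')) ∧ ∀ z ∈ β.support, z ∉ K := by
  have hSpK : ∀ z, z ∈ Sp → z ∈ K := fun z hz => (hK z).2 (Or.inl hz)
  constructor
  · rintro ⟨hpre, τ'', hτ, hτ''L, hlen, hsuf, hmid⟩
    have hinj := γ.isPath.getVert_injOn
    have e₁ : γ.walk.getVert τ = p.getVert τ := hpre τ le_rfl
    have e₂ : (γ.walk.drop τ).getVert (τ'' - τ) = p.getVert τ' := by
      rw [SimpleGraph.Walk.drop_getVert, Nat.add_sub_cancel' hτ, ← add_zero τ'', hsuf 0, add_zero]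
    have hβlen : (((γ.walk.drop τ).take (τ'' - τ)).copy e₁ e₂).length = τ'' - τ := by
      rw [SimpleGraph.Walk.length_copy, SimpleGraph.Walk.take_length, SimpleGraph.Walk.drop_length]
      omega
    have hβget : ∀ m, (((γ.walk.drop τ).take (τ'' - τ)).copy e₁ e₂).getVert m =
        γ.walk.getVert (τ + min (τ'' - τ) m) := fun m => by
      rw [SimpleGraph.Walk.getVert_copy, SimpleGraph.Walk.take_getVert, SimpleGraph.Walk.drop_getVert]
    refine ⟨((γ.walk.drop τ).take (τ'' - τ)).copy e₁ e₂, ?_, ?_⟩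
    · apply SimpleGraph.Walk.ext_getVert_le_length
      · rw [SimpleGraph.Walk.length_append, SimpleGraph.Walk.length_append, hβlen,
          SimpleGraph.Walk.take_length, SimpleGraph.Walk.drop_length]
        omega
      · intro k hk
        rw [getVert_take_append_append_drop p hττ' hτ'L, hβlen]
        split_ifs with h₁ h₂
        · exact hpre k h₁.le
        · rw [hβget, min_eq_right (by omega)]
          congr 1
          omega
        · rw [show k - (τ'' - τ) + τ' - τ = τ' + (k - τ'') by omega, ← hsuf]
          congr 1
          omega
    · intro z hz hzK
      rw [SimpleGraph.Walk.support_copy, mem_support_take_iff (by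
        rw [SimpleGraph.Walk.drop_length]; omega)] at hz
      obtain ⟨m, hm, rfl⟩ := hz
      rw [SimpleGraph.Walk.drop_getVert] at hzK
      rcases (hK _).1 hzK with hzS | ⟨m', hm'L, hm', hm'eq⟩
      · exact hmid (τ + m) (Nat.le_add_right _ _) (by omega) hzS
      rcases hm' with hm' | hm'
      · -- a prefix vertex: `p m' = γ m'` and `γ` is self-avoiding
        rw [← hpre m' hm'.le] at hm'eq
        have h' := hinj (by simp only [Set.mem_setOf_eq]; omega) (by simp only [Set.mem_setOf_eq]; omega) hm'eq
        omega
      · -- a suffix vertex: `p m' = γ (τ'' + (m' - τ'))`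
        rw [show m' = τ' + (m' - τ') by omega, ← hsuf] at hm'eq
        have h' := hinj (by simp only [Set.mem_setOf_eq]; omega) (by simp only [Set.mem_setOf_eq]; omega) hm'eq
        omega
  · rintro ⟨β, hγ, hβK⟩
    have hL : γ.walk.length = τ + β.length + (p.length - τ') := by
      rw [hγ, SimpleGraph.Walk.length_append, SimpleGraph.Walk.length_append,
        SimpleGraph.Walk.take_length, SimpleGraph.Walk.drop_length, min_eq_left (hττ'.trans hτ'L)]
      ring
    have hget : ∀ k, γ.walk.getVert k = if k < τ then p.getVert k
        else if k ≤ τ + β.length then β.getVert (k - τ) else p.getVert (k - β.length + τ' - τ) := fun k => by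
      rw [hγ]; exact getVert_take_append_append_drop p hττ' hτ'L β k
    refine ⟨fun m hm => ?_, τ + β.length, Nat.le_add_right _ _, by omega, by omega, fun m => ?_,
      fun m hm hm' => ?_⟩
    · rw [hget]
      split_ifs with h₁ h₂
      · rfl
      · rw [show m = τ by omega, Nat.sub_self, SimpleGraph.Walk.getVert_zero]
      · exfalso; omega
    · rw [hget]
      split_ifs with h₁ h₂
      · exfalso; omega
      · rw [show τ + β.length + m - τ = β.length by omega, SimpleGraph.Walk.getVert_length,
          show m = 0 by omega, add_zero]
      · congr 1; omega
    · intro hmS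
      refine hβK (β.getVert (m - τ)) (β.getVert_mem_support _) (hSpK _ ?_)
      rw [hget] at hmS
      split_ifs at hmS with h₁
      · exfalso; omega
      · exact hmS

/-- **The bead identity for the far-tip slot** (`GatesByBubbleDoorsByFKG.necklace_beadIdentity`, p126690, with
`ω₁ := p.take τ`, `ω₂ := p.drop τ'`, `u := p τ`, `u' := p τ'` and `K` = spine ∪ prefix ∪ suffix vertices):
for a self-avoiding chord `p` whose vertices at `τ ≤ τ'` are off the spine and every `Ω'` whose graph is
`Ω_δ` restricted to `Keep(p τ', K)`, `w_{Ω,a₀,b₀}(γ = ω₁ · β · ω₂, β avoids K, P(β)) =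
x_c^{|ω₁| + |ω₂|} · w_{Ω', p τ, p τ'}(P)` for every event `P` read on the vertex sequence. [folklore] -/
theorem weight_slotBead_eq {Sp K : Set (Site 2)} {p : (discreteDomainGraph Ω δ).Walk a₀ b₀} (hp : p.IsPath)
    {τ τ' : ℕ} (hττ' : τ ≤ τ') (hτ'L : τ' ≤ p.length) (hτS : p.getVert τ ∉ Sp) (hτ'S : p.getVert τ' ∉ Sp)
    (hK : ∀ z, z ∈ K ↔ z ∈ Sp ∨ ∃ m, m ≤ p.length ∧ (m < τ ∨ τ' < m) ∧ p.getVert m = z)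
    (hadj : ∀ x y, (discreteDomainGraph Ω' δ).Adj x y ↔
      ((discreteDomainGraph Ω δ).Adj x y ∧
        (∃ q : (discreteDomainGraph Ω δ).Walk x (p.getVert τ'), ∀ v ∈ q.support, v ∉ K) ∧
        (∃ q : (discreteDomainGraph Ω δ).Walk y (p.getVert τ'), ∀ v ∈ q.support, v ∉ K)))
    (P : List (Site 2) → Prop) :
    weight Ω δ a₀ b₀ {γ | ∃ β : (discreteDomainGraph Ω δ).Walk (p.getVert τ) (p.getVert τ'),
        γ.walk = (p.take τ).append (β.append (p.drop τ')) ∧ (∀ v ∈ β.support, v ∉ K) ∧ P β.support} =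
      ENNReal.ofReal (criticalFugacity ^ ((p.take τ).length + (p.drop τ').length)) *
        weight Ω' δ (p.getVert τ) (p.getVert τ') {γ' | P γ'.walk.support} := by
  have hinj := hp.getVert_injOn
  have hτL : τ ≤ p.length := hττ'.trans hτ'L
  -- the two tips are off `K`
  have htK : ∀ {σ}, τ ≤ σ → σ ≤ τ' → p.getVert σ ∉ Sp → p.getVert σ ∉ K := by
    intro σ h₁ h₂ hS hKσ
    rcases (hK _).1 hKσ with h | ⟨m, hmL, hm, hmeq⟩
    · exact hS h
    · have h' := hinj (show m ∈ {i | i ≤ p.length} from hmL)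
        (show σ ∈ {i | i ≤ p.length} by simp only [Set.mem_setOf_eq]; omega) hmeq
      omega
  refine GatesByBubbleDoorsByFKG.necklace_beadIdentity Ω Ω' δ a₀ _ _ b₀ K (p.take τ) (p.drop τ')
    (hp.take τ) (hp.drop τ') (fun z hz₂ hz₁ => ?_) (htK le_rfl hττ' hτS) (htK hττ' le_rfl hτ'S)
    (fun z hz hzt => ?_) (fun z hz hzt => ?_) hadj P
  · -- `ω₂` meets `ω₁` at most at `p τ` (then `τ = τ'`)
    obtain ⟨m, hτ'm, hmL, rfl⟩ := (mem_support_drop_iff hτ'L).1 hz₂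
    obtain ⟨m', hm', hmeq⟩ := (mem_support_take_iff hτL).1 hz₁
    have h' := hinj (show m' ∈ {i | i ≤ p.length} by simp only [Set.mem_setOf_eq]; omega)
      (show m ∈ {i | i ≤ p.length} from hmL) hmeq
    rw [← hmeq]
    congr 1
    omega
  · obtain ⟨m, hm, rfl⟩ := (mem_support_take_iff hτL).1 hz
    refine (hK _).2 (Or.inr ⟨m, by omega, Or.inl (lt_of_le_of_ne hm fun h => hzt ?_), rfl⟩)
    rw [h]
  · obtain ⟨m, hτ'm, hmL, rfl⟩ := (mem_support_drop_iff hτ'L).1 hz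
    refine (hK _).2 (Or.inr ⟨m, hmL, Or.inr (lt_of_le_of_ne hτ'm fun h => hzt ?_), rfl⟩)
    rw [h]

/-- **Product formula, inequality form (S2).**  If two events `X ⊇ X_P` of the chords of `Ω_δ` from `a` to `b`
have weights `c · Z_{Ω'}(u, u')` and `c · w_{Ω'}(u, u')(W)` (the bead identity with `P := True` and with `P`),
`Z_{Ω'}(u, u') < ∞` and `law_{Ω'}(u, u')(W) ≤ ε`, then `w_Ω(X_P) ≤ ε · w_Ω(X)`: `w(W) = Z · law(W)` when
`Z ≠ 0`, and both sides vanish when `Z = 0`. [folklore] -/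
theorem weight_le_ofReal_mul_weight {a b u u' : Site 2} {X XP : Set (DomainSAW Ω δ a b)} {c : ℝ≥0∞}
    {W : Set (DomainSAW Ω' δ u u')} {ε : ℝ}
    (hX : weight Ω δ a b X = c * weight Ω' δ u u' Set.univ)
    (hXP : weight Ω δ a b XP = c * weight Ω' δ u u' W)
    (hfin : weight Ω' δ u u' Set.univ ≠ ∞) (hW : law Ω' δ u u' W ≤ ENNReal.ofReal ε) :
    weight Ω δ a b XP ≤ ENNReal.ofReal ε * weight Ω δ a b X := by
  rw [hX, hXP]
  set Z := weight Ω' δ u u' Set.univ with hZ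
  by_cases hZ0 : Z = 0
  · have hW0 : weight Ω' δ u u' W = 0 :=
      le_antisymm ((measure_mono (Set.subset_univ W)).trans hZ0.le) bot_le
    rw [hW0, mul_zero]
    exact bot_le
  · rw [law, Measure.smul_apply, smul_eq_mul] at hW
    have hWZ : weight Ω' δ u u' W = Z * (Z⁻¹ * weight Ω' δ u u' W) := by
      rw [← mul_assoc, ENNReal.mul_inv_cancel hZ0 hfin, one_mul]
    calc c * weight Ω' δ u u' W = c * (Z * (Z⁻¹ * weight Ω' δ u u' W)) := by rw [← hWZ]
      _ ≤ c * (Z * ENNReal.ofReal ε) := by gcongr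
      _ = ENNReal.ofReal ε * (c * Z) := by ring

/-- **Registered form of the slot's bead identity** (crux stmt-CriticalPhenomena-1878, line `slit-necklace`,
helper of `stub_slotLaw`; `weight_slotBead_eq` with all binders explicit): for a self-avoiding chord `p` of
`Ω_δ` from `a₀` to `b₀`, indices `τ ≤ τ' ≤ |p|` with `p τ, p τ' ∉ Sp`, `K` = `Sp` ∪ the vertices of `p` of index
`< τ` or `> τ'`, and `Ω'` presenting `Ω_δ` restricted to `Keep(p τ', K)`:
`w_{Ω,a₀,b₀}(γ = p.take τ · β · p.drop τ', β avoids K, P(β)) = x_c^{|p.take τ| + |p.drop τ'|} · w_{Ω', p τ, p τ'}(P)`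
(`GatesByBubbleDoorsByFKG.necklace_beadIdentity`, p126690). [folklore] -/
theorem slot_beadIdentity :
    ∀ (Ω Ω' : Set ℂ) (δ : ℝ) (a₀ b₀ : Site 2) (Sp K : Set (Site 2)) (p : (discreteDomainGraph Ω δ).Walk a₀ b₀)
      (τ τ' : ℕ), p.IsPath → τ ≤ τ' → τ' ≤ p.length → p.getVert τ ∉ Sp → p.getVert τ' ∉ Sp →
      (∀ z, z ∈ K ↔ z ∈ Sp ∨ ∃ m, m ≤ p.length ∧ (m < τ ∨ τ' < m) ∧ p.getVert m = z) →
      (∀ x y, (discreteDomainGraph Ω' δ).Adj x y ↔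
        ((discreteDomainGraph Ω δ).Adj x y ∧
          (∃ q : (discreteDomainGraph Ω δ).Walk x (p.getVert τ'), ∀ v ∈ q.support, v ∉ K) ∧
          (∃ q : (discreteDomainGraph Ω δ).Walk y (p.getVert τ'), ∀ v ∈ q.support, v ∉ K))) →
      ∀ P : List (Site 2) → Prop,
        SAW.weight Ω δ a₀ b₀ {γ | ∃ β : (discreteDomainGraph Ω δ).Walk (p.getVert τ) (p.getVert τ'),
            γ.walk = (p.take τ).append (β.append (p.drop τ')) ∧ (∀ v ∈ β.support, v ∉ K) ∧ P β.support} =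
          ENNReal.ofReal (SAW.criticalFugacity ^ ((p.take τ).length + (p.drop τ').length)) *
            SAW.weight Ω' δ (p.getVert τ) (p.getVert τ') {γ' | P γ'.walk.support} :=
  fun _ _ _ _ _ _ _ _ _ _ hp hττ' hτ'L hτS hτ'S hK hadj P => weight_slotBead_eq hp hττ' hτ'L hτS hτ'S hK hadj P

end SlotBead

end Summit.CriticalPhenomena.SAWScalingLimit.Theorems.FKGToTraversalBound.SlitNecklace

end
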